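import Mathlib.Analysis.SpecialFunctions.Integrals.Basic
import Mathlib.Analysis.SpecialFunctions.Trigonometric.InverseDeriv
import Mathlib.Analysis.SpecialFunctions.Sqrt
import Mathlib.Analysis.SumIntegralComparisons
import HarnessLib

/-!
# The Vershik–Kerov hook integral: the cell kernel `K(h)` and the diagonal sum `S_N`

Topic `Literature/RepresentationTheory/FiniteGroups`; analytic bricks of the Vershik–Kerov upper
bound `max_{λ ⊢ N} dim λ ≤ √(N!) e^{-c₂√N(1+o(1))}`, `c₂ = (π-2)/π²` (Vershik–Kerov 1985; the
named fact `VershikKerov1985_maxCharDegree` of `VershikKerovMaxDegree.lean`). The printed proof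
(Vershik–Kerov 1985, Lemmas 1–4 and §3; reproduced in S. Mkrtchyan, *Asymptotics of the maximal
and the typical dimensions of isotypic components of tensor representations of the symmetric
group*, Europ. J. Combin. 33 (2012), arXiv:1008.3854, Prop. 3.1, Prop. 4.1 and §5; restated as
Prop. 2.1 of A. Aggarwal, D. Elboim, arXiv:2605.25995 (2026)) has three steps, for a diagram
`λ ⊢ N` with rotated lattice boundary `f` (slopes `±1`) and hook lengths `h(c)`:

1. (Lemma 1) `∑_c log h(c)² = 2 J(f) + ∑_c φ(h(c))`, `J(f) = ∑_c K(h(c))` the hook integral,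
   `K(h) = ∫₀¹∫₀¹ log(h + t - s) dt ds`, `φ ≥ 0`;
2. (Lemmas 2–4) the exact expansion around the limit shape `Ω_N(x) = √(4N) Ω(x/√(4N))`,
   `Ω(u) = (2/π)(u arcsin u + √(1-u²))`: `J(f) = ½(N log N - N) + (1/16) θ_N(f) + ½ θ̄_N(f)` with
   `θ_N(f) = ∬ ((g(x)-g(y))/(x-y))² dx dy`, `g = f - Ω_N`, and `θ̄_N(f) ≥ 0`;
3. (§3, "a very rough estimate") keep only the diagonal unit squares of `θ_N`: on `[k, k+1]²` the
   integrand is `≥ (1 - |Ω_N'|)²`, `Ω_N'(x) = (2/π) arcsin(x/(2√N))`, so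
   `θ_N(f) ≥ S_N := 2 ∑_{j=1}^{⌊2√N⌋} ψ(j/(2√N))`, `ψ(u) = (1 - (2/π) arcsin u)²`, and
   `S_N = 2√N ∫_{-1}^{1}(1 - |Ω'|)² + O(1) = 16 c₂ √N + O(1)`.

PROVED here: step 1 in inequality form and the size of `S_N` in step 3:

* `vkHookKernel h = K(h)` (iterated interval integrals), `vkHookKernel_eq` (the inner integral in
  closed form, `∫₀¹ log(c+t) dt = (c+1)log(c+1) - c log c - 1`), and **`vkHookKernel_le_log`:
  `K(h) ≤ log h` for `h ≥ 1`** (pair `s` with `1 - s`: `∫_a^{a+1}(log v + log(2h - v)) dv ≤ 2 log h`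
  by `v(2h - v) ≤ h²`);
* `vkPsi u = ψ(u)`, antitone on `[0, ∞)`, `0 ≤ ψ ≤ 1` there, and **`integral_vkPsi`:
  `∫₀¹ ψ = 4/π - 8/π² = 4(π-2)/π²`** (explicit antiderivative);
* `vkDiagSum N = S_N` and **`vkDiagSum_ge`: `S_N ≥ 2(2√N(4/π - 8/π²) - 1) = 16 c₂ √N - 2`**
  (Riemann sum of an antitone function, Mathlib `AntitoneOn.integral_le_sum_Ico`).

Step 2 (the limit-shape calculus: the `H^{1/2}` identity `-∬ log|x-y| g'g' = ½‖g‖²_{1/2}` and the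
logarithmic potential of the arcsine law) is NOT here; the reduction of the named fact to it is
`VershikKerovUpperReduction.lean`.

## References

* A. M. Vershik, S. V. Kerov, Funct. Anal. Appl. 19 (1985) 21–31, Lemma 1 and §3. [VershikKerov1985]
* S. Mkrtchyan, Europ. J. Combin. 33 (2012) 1631–1652, arXiv:1008.3854, Prop. 3.1 (the expansion
  with `m(h) = ∑_k 1/(k(k+1)(2k+1)h^{2k})`) and §5 (the diagonal slices, `α_c = ¼∫(sign z - Ω_c')²`).
* A. Aggarwal, D. Elboim, arXiv:2605.25995 (2026), Prop. 2.1 and (2.4)–(2.6).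

## Mathlib

`integral_log`, `intervalIntegral.integral_comp_add_left` / `integral_comp_sub_left` /
`integral_comp_div`, `intervalIntegral.integral_mono_on(_of_le_Ioo)`, `intervalIntegrable_log'`,
`Real.hasDerivAt_arcsin`, `HasDerivAt.sqrt`, `intervalIntegral.integral_eq_sub_of_hasDerivAt_of_le`,
`AntitoneOn.integral_le_sum_Ico`, `Real.monotone_arcsin`. No limit-shape material exists in Mathlib.
-/

noncomputable section

open Real Finset MeasureTheory intervalIntegral Set
open scoped BigOperators

namespace Literature.RepresentationTheory.FiniteGroups

/-! ### The cell kernel `K(h) = ∫₀¹∫₀¹ log(h + t - s) dt ds` -/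

/-- **The hook-integral kernel** `K(h) = ∫₀¹ ∫₀¹ log(h + t - s) dt ds`: the double integral of
`log(y - x)` over the pair of unit boundary steps `[i, i+1] ∋ x`, `[j, j+1] ∋ y`, `j - i = h`, that
bound the hook of a cell of hook length `h` (Vershik–Kerov 1985, Lemma 1: `log h² = 2K(h) + φ(h)`;
Mkrtchyan 2012, proof of Prop. 3.1). Iterated interval integrals. [cite: VershikKerov1985, Lemma 1] -/
def vkHookKernel (h : ℝ) : ℝ :=
  ∫ s in (0 : ℝ)..1, ∫ t in (0 : ℝ)..1, Real.log (h + t - s)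

/-- `∫₀¹ log(c + t) dt = (c+1) log(c+1) - c log c - 1` (Mathlib `integral_log`, valid for every
real `c` with the convention `0 log 0 = 0`). [folklore] -/
theorem integral_log_add_unit (c : ℝ) :
    ∫ t in (0 : ℝ)..1, Real.log (c + t) = (c + 1) * Real.log (c + 1) - c * Real.log c - 1 := by
  rw [intervalIntegral.integral_comp_add_left (fun t => Real.log t) c, add_zero, integral_log]
  ring

/-- `∫_c^{c+1} log v dv = (c+1) log(c+1) - c log c - 1`. [folklore] -/
theorem integral_log_unit (c : ℝ) :
    ∫ v in c..c + 1, Real.log v = (c + 1) * Real.log (c + 1) - c * Real.log c - 1 := by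
  rw [integral_log]
  ring

/-- The inner integral in closed form:
`K(h) = ∫₀¹ ((h-s+1) log(h-s+1) - (h-s) log(h-s) - 1) ds`. [cite: VershikKerov1985, Lemma 1] -/
theorem vkHookKernel_eq (h : ℝ) :
    vkHookKernel h = ∫ s in (0 : ℝ)..1,
      ((h - s + 1) * Real.log (h - s + 1) - (h - s) * Real.log (h - s) - 1) := by
  unfold vkHookKernel
  refine intervalIntegral.integral_congr fun s _ => ?_
  have : (fun t : ℝ => Real.log (h + t - s)) = fun t => Real.log ((h - s) + t) := by
    ext t; ring_nf
  simp only [this, integral_log_add_unit]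

/-- The AM–GM step: `∫_a^{a+1} log v dv + ∫_{2h-1-a}^{2h-a} log v dv ≤ 2 log h` for `h ≥ 1`,
`h - 1 ≤ a ≤ h` (substitute `v ↦ 2h - v` in the second integral; `log v + log(2h - v) ≤ log h²`
on `(a, a+1) ⊆ (0, 2h)` since `v(2h - v) ≤ h²`). [folklore] -/
theorem integral_log_pair_le {h a : ℝ} (hh : 1 ≤ h) (ha1 : h - 1 ≤ a) (ha2 : a ≤ h) :
    (∫ v in a..a + 1, Real.log v) + (∫ v in (2 * h - 1 - a)..(2 * h - a), Real.log v) ≤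
      2 * Real.log h := by
  have hsub : (∫ v in (2 * h - 1 - a)..(2 * h - a), Real.log v) =
      ∫ w in a..a + 1, Real.log (2 * h - w) := by
    rw [intervalIntegral.integral_comp_sub_left (fun v => Real.log v) (2 * h)]
    congr 1
    ring
  have hint : IntervalIntegrable (fun w => Real.log (2 * h - w)) volume a (a + 1) := by
    simpa only [sub_sub_cancel] using
      (intervalIntegrable_log' (a := 2 * h - a) (b := 2 * h - (a + 1))).comp_sub_left (2 * h)
  rw [hsub, ← intervalIntegral.integral_add intervalIntegrable_log' hint]
  have hle : a ≤ a + 1 := by linarith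
  calc ∫ w in a..a + 1, (Real.log w + Real.log (2 * h - w))
      ≤ ∫ _ in a..a + 1, 2 * Real.log h := by
        refine intervalIntegral.integral_mono_on_of_le_Ioo hle
          (intervalIntegrable_log'.add hint) intervalIntegrable_const fun w hw => ?_
        have hw0 : 0 < w := by linarith [hw.1]
        have hw1 : 0 < 2 * h - w := by linarith [hw.2]
        rw [← Real.log_mul hw0.ne' hw1.ne', show 2 * Real.log h = Real.log (h ^ 2) by
          rw [Real.log_pow]; norm_num]
        exact Real.log_le_log (mul_pos hw0 hw1) (by nlinarith [sq_nonneg (w - h)])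
    _ = 2 * Real.log h := by simp

/-- **`K(h) ≤ log h` for `h ≥ 1`** — Vershik–Kerov 1985, Lemma 1, in inequality form
(`log h² = 2K(h) + φ(h)`, `φ(h) = ∑_k 1/(k(k+1)(2k+1)h^{2k}) ≥ 0`; Mkrtchyan 2012, Prop. 3.1, `m(h)`).
Proof: with `q(c) = ∫_c^{c+1} log`, `K(h) = ∫₀¹ q(h - s) ds = ∫₀¹ q(h - 1 + s) ds`, and
`q(h - s) + q(h - 1 + s) ≤ 2 log h` pointwise (`integral_log_pair_le`). [cite: VershikKerov1985, Lemma 1] -/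
theorem vkHookKernel_le_log {h : ℝ} (hh : 1 ≤ h) : vkHookKernel h ≤ Real.log h := by
  -- `q c = ∫_c^{c+1} log`
  set q : ℝ → ℝ := fun c => (c + 1) * Real.log (c + 1) - c * Real.log c - 1 with hq
  have hq_cont : Continuous q := by
    have h1 : Continuous fun c : ℝ => (c + 1) * Real.log (c + 1) :=
      Real.continuous_mul_log.comp (continuous_add_const 1)
    exact (h1.sub Real.continuous_mul_log).sub continuous_const
  have hK : vkHookKernel h = ∫ s in (0 : ℝ)..1, q (h - s) := by
    rw [vkHookKernel_eq]
  -- symmetry `s ↦ 1 - s`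
  have hsymm : (∫ s in (0 : ℝ)..1, q (h - s)) = ∫ s in (0 : ℝ)..1, q (h - 1 + s) := by
    rw [intervalIntegral.integral_comp_sub_left q h, intervalIntegral.integral_comp_add_left q (h - 1)]
    norm_num
  have hi1 : IntervalIntegrable (fun s => q (h - s)) volume 0 1 :=
    (hq_cont.comp (continuous_sub_left h)).intervalIntegrable _ _
  have hi2 : IntervalIntegrable (fun s => q (h - 1 + s)) volume 0 1 :=
    (hq_cont.comp (continuous_const_add (h - 1))).intervalIntegrable _ _
  have h2K : 2 * vkHookKernel h = ∫ s in (0 : ℝ)..1, (q (h - s) + q (h - 1 + s)) := by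
    rw [intervalIntegral.integral_add hi1 hi2, ← hsymm, hK, two_mul]
  have hpt : ∀ s ∈ Icc (0 : ℝ) 1, q (h - s) + q (h - 1 + s) ≤ 2 * Real.log h := by
    intro s hs
    have e1 : q (h - s) = ∫ v in (h - s)..(h - s + 1), Real.log v := (integral_log_unit _).symm
    have e2 : q (h - 1 + s) = ∫ v in (2 * h - 1 - (h - s))..(2 * h - (h - s)), Real.log v := by
      rw [show 2 * h - 1 - (h - s) = h - 1 + s by ring,
        show 2 * h - (h - s) = h - 1 + s + 1 by ring]
      exact (integral_log_unit _).symm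
    rw [e1, e2]
    exact integral_log_pair_le hh (by linarith [hs.2]) (by linarith [hs.1])
  have hfin : (∫ s in (0 : ℝ)..1, (q (h - s) + q (h - 1 + s))) ≤
      ∫ _ in (0 : ℝ)..1, 2 * Real.log h :=
    intervalIntegral.integral_mono_on zero_le_one (hi1.add hi2) intervalIntegrable_const hpt
  rw [intervalIntegral.integral_const, sub_zero, one_smul] at hfin
  linarith [h2K]




/-! ### The slope gap `ψ(u) = (1 - (2/π) arcsin u)²` and its integral -/

/-- `ψ(u) = (1 - (2/π) arcsin u)²`: the squared gap between the slope `1` of a lattice boundary and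
the slope `Ω'(u) = (2/π) arcsin u` of the Logan–Shepp–Vershik–Kerov limit shape
`Ω(u) = (2/π)(u arcsin u + √(1 - u²))` (Vershik–Kerov 1985, §3; Mkrtchyan 2012, §5:
`α = ¼ ∫ (sign z - Ω'(z))² dz`). [cite: VershikKerov1985, §3] -/
def vkPsi (u : ℝ) : ℝ := (1 - 2 / π * Real.arcsin u) ^ 2

/-- `ψ ≥ 0`. [folklore] -/
theorem vkPsi_nonneg (u : ℝ) : 0 ≤ vkPsi u := sq_nonneg _

/-- `(2/π) arcsin u ≤ 1`. [folklore] -/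
theorem two_div_pi_mul_arcsin_le_one (u : ℝ) : 2 / π * Real.arcsin u ≤ 1 := by
  have h := Real.arcsin_le_pi_div_two u
  rw [div_mul_eq_mul_div, div_le_one Real.pi_pos]
  linarith

/-- `ψ(u) ≤ 1` for `u ≥ 0`. [folklore] -/
theorem vkPsi_le_one {u : ℝ} (hu : 0 ≤ u) : vkPsi u ≤ 1 := by
  have h0 : 0 ≤ 2 / π * Real.arcsin u :=
    mul_nonneg (div_nonneg zero_le_two Real.pi_pos.le) (Real.arcsin_nonneg.mpr hu)
  have h1 := two_div_pi_mul_arcsin_le_one u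
  unfold vkPsi
  nlinarith

/-- `ψ` is antitone on `[0, ∞)` (`arcsin` is monotone and `(2/π) arcsin ≤ 1`). [folklore] -/
theorem vkPsi_antitoneOn : AntitoneOn vkPsi (Ici 0) := by
  intro u hu v _ huv
  have hu0 : 0 ≤ 2 / π * Real.arcsin u :=
    mul_nonneg (div_nonneg zero_le_two Real.pi_pos.le) (Real.arcsin_nonneg.mpr hu)
  have hmono : 2 / π * Real.arcsin u ≤ 2 / π * Real.arcsin v :=
    mul_le_mul_of_nonneg_left (Real.monotone_arcsin huv) (div_nonneg zero_le_two Real.pi_pos.le)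
  have h1 := two_div_pi_mul_arcsin_le_one v
  unfold vkPsi
  nlinarith

/-- `ψ` is continuous. [folklore] -/
theorem continuous_vkPsi : Continuous vkPsi := by
  unfold vkPsi
  fun_prop

/-- **`∫₀¹ (1 - (2/π) arcsin u)² du = 4/π - 8/π² = 4(π-2)/π²`** (so that
`¼∫_{-1}^{1}(sign z - Ω'(z))² dz = 2(π-2)/π²`, the Vershik–Kerov constant for `-log(dim²λ/N!)/√N`,
i.e. `c₂ = (π-2)/π²` for `dim λ/√(N!)`), by the antiderivative
`u - (4/π)(u arcsin u + √(1-u²)) + (4/π²)(u arcsin² u + 2√(1-u²) arcsin u - 2u)` on `(0, 1)`.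
[cite: VershikKerov1985, §3] -/
theorem integral_vkPsi : ∫ u in (0 : ℝ)..1, vkPsi u = 4 / π - 8 / π ^ 2 := by
  set a : ℝ := 2 / π with ha
  set F : ℝ → ℝ := fun u => u - 2 * a * (u * Real.arcsin u + Real.sqrt (1 - u ^ 2)) +
    a ^ 2 * (u * Real.arcsin u ^ 2 + 2 * Real.sqrt (1 - u ^ 2) * Real.arcsin u - 2 * u) with hF
  have hderiv : ∀ u ∈ Ioo (0 : ℝ) 1, HasDerivAt F (vkPsi u) u := by
    intro u hu
    have hu1 : u ≠ -1 := by linarith [hu.1]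
    have hu2 : u ≠ 1 := hu.2.ne
    have hpos : 0 < 1 - u ^ 2 := by nlinarith [hu.1, hu.2]
    have hsq : Real.sqrt (1 - u ^ 2) ≠ 0 := (Real.sqrt_pos.mpr hpos).ne'
    have hA : HasDerivAt Real.arcsin (1 / Real.sqrt (1 - u ^ 2)) u := Real.hasDerivAt_arcsin hu1 hu2
    have hQ : HasDerivAt (fun u : ℝ => 1 - u ^ 2) (-(2 * u)) u := by
      simpa using (hasDerivAt_pow 2 u).const_sub 1
    have hS : HasDerivAt (fun u : ℝ => Real.sqrt (1 - u ^ 2)) (-(2 * u) / (2 * Real.sqrt (1 - u ^ 2))) u :=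
      hQ.sqrt hpos.ne'
    have hI : HasDerivAt (fun u : ℝ => u) 1 u := hasDerivAt_id u
    -- assemble
    have hF' : HasDerivAt F
        (1 - 2 * a * ((1 * Real.arcsin u + u * (1 / Real.sqrt (1 - u ^ 2))) +
            -(2 * u) / (2 * Real.sqrt (1 - u ^ 2))) +
          a ^ 2 * ((1 * Real.arcsin u ^ 2 + u * (2 * Real.arcsin u ^ 1 * (1 / Real.sqrt (1 - u ^ 2)))) +
            (2 * (-(2 * u) / (2 * Real.sqrt (1 - u ^ 2))) * Real.arcsin u +
              2 * Real.sqrt (1 - u ^ 2) * (1 / Real.sqrt (1 - u ^ 2))) - 2 * 1)) u := by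
      refine (hI.sub (((hI.mul hA).add hS).const_mul (2 * a))).add ?_
      refine HasDerivAt.const_mul (a ^ 2) (((hI.mul (hA.pow 2)).add ?_).sub (hI.const_mul 2))
      exact (hS.const_mul 2).mul hA
    convert hF' using 1
    unfold vkPsi
    rw [← ha]
    field_simp
    ring
  have hcont : ContinuousOn F (Icc 0 1) := by
    have : Continuous F := by
      rw [hF]
      fun_prop
    exact this.continuousOn
  have hint : IntervalIntegrable vkPsi volume 0 1 := continuous_vkPsi.intervalIntegrable _ _
  have hF0 : F 0 = -(2 * a) := by
    simp only [hF]
    rw [Real.arcsin_zero, zero_pow two_ne_zero, sub_zero, Real.sqrt_one]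
    ring
  have hF1 : F 1 = 1 - 2 * a * (π / 2) + a ^ 2 * ((π / 2) ^ 2 - 2) := by
    simp only [hF]
    rw [Real.arcsin_one, one_pow, sub_self, Real.sqrt_zero]
    ring
  rw [intervalIntegral.integral_eq_sub_of_hasDerivAt_of_le zero_le_one hcont hderiv hint, hF1, hF0,
    ha]
  field_simp
  ring



/-! ### The diagonal sum `S_N` and its size -/

/-- **The diagonal sum** `S_N := 2 ∑_{j=1}^{⌊2√N⌋} ψ(j/(2√N))` (written over `Finset.Ico 1 (⌊2√N⌋+1)`):
the diagonal-slices lower bound for `θ_N(f) = ∬((g(x)-g(y))/(x-y))²`, `g = f - Ω_N`, of a lattice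
boundary `f` of a diagram with `N` boxes — each unit square `[k, k+1]²`, `-⌊2√N⌋ ≤ k < ⌊2√N⌋`,
contributes at least `(1 - sup_{[k,k+1]}|Ω_N'|)² = ψ(max(|k|,|k+1|)/(2√N))`, `Ω_N'(x) = (2/π) arcsin(x/(2√N))`
(Vershik–Kerov 1985, §3; Mkrtchyan 2012, §5, "we only consider the contribution of diagonal slices
in the double integral `‖f‖²_{1/2}` and use that `L_λ` is piecewise linear with slopes `±1`").
[cite: VershikKerov1985, §3] -/
def vkDiagSum (N : ℕ) : ℝ :=
  2 * ∑ j ∈ Finset.Ico 1 (⌊2 * Real.sqrt N⌋₊ + 1), vkPsi ((j : ℝ) / (2 * Real.sqrt N))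

/-- `S_N ≥ 0`. [folklore] -/
theorem vkDiagSum_nonneg (N : ℕ) : 0 ≤ vkDiagSum N :=
  mul_nonneg zero_le_two (Finset.sum_nonneg fun _ _ => vkPsi_nonneg _)

/-- **`S_N ≥ 2(2√N ∫₀¹ψ - 1) = 16 (π-2)/π² · √N - 2`** for `N ≥ 1`: the Riemann sum of the antitone
`x ↦ ψ(x/(2√N))` over `j = 1, …, ⌊2√N⌋` dominates `∫_1^{2√N} ψ(x/(2√N)) dx = 2√N ∫₀¹ ψ - ∫₀¹ ψ(x/(2√N)) dx`
(Vershik–Kerov 1985, §3: "replacing the Riemann sum by the corresponding integral").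
[cite: VershikKerov1985, §3] -/
theorem vkDiagSum_ge {N : ℕ} (hN : 1 ≤ N) :
    2 * (2 * Real.sqrt N * (4 / π - 8 / π ^ 2) - 1) ≤ vkDiagSum N := by
  set L : ℝ := 2 * Real.sqrt N with hL
  have hL1 : 1 ≤ L := by
    have h1 : (1 : ℝ) ≤ Real.sqrt N := by
      rw [show (1 : ℝ) = Real.sqrt 1 from Real.sqrt_one.symm]
      exact Real.sqrt_le_sqrt (by exact_mod_cast hN)
    linarith
  have hL0 : 0 < L := by linarith
  set m : ℕ := ⌊L⌋₊ with hm
  have hmL : L < (m : ℝ) + 1 := Nat.lt_floor_add_one L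
  set g : ℝ → ℝ := fun x => vkPsi (x / L) with hg
  have hg_anti : AntitoneOn g (Ici 0) := fun x hx y hy hxy =>
    vkPsi_antitoneOn (div_nonneg hx hL0.le) (div_nonneg hy hL0.le)
      (div_le_div_of_nonneg_right hxy hL0.le)
  have hg_cont : Continuous g := continuous_vkPsi.comp (continuous_id.div_const L)
  have hg_nonneg : ∀ x, 0 ≤ g x := fun x => vkPsi_nonneg _
  have hg_le_one : ∀ x, 0 ≤ x → g x ≤ 1 := fun x hx => vkPsi_le_one (div_nonneg hx hL0.le)
  -- (1) the sum dominates `∫_1^{m+1} g`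
  have h1 : ∫ x in ((1 : ℕ) : ℝ)..((m + 1 : ℕ) : ℝ), g x ≤ ∑ j ∈ Finset.Ico 1 (m + 1), g j :=
    AntitoneOn.integral_le_sum_Ico (by omega)
      (hg_anti.mono fun x hx => le_trans (by exact_mod_cast Nat.zero_le 1) hx.1)
  rw [Nat.cast_one] at h1
  -- (2) `∫_1^L g ≤ ∫_1^{m+1} g`
  have h2 : ∫ x in (1 : ℝ)..L, g x ≤ ∫ x in (1 : ℝ)..((m + 1 : ℕ) : ℝ), g x := by
    refine intervalIntegral.integral_mono_interval le_rfl hL1 (by push_cast; exact hmL.le)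
      (Filter.Eventually.of_forall fun x => hg_nonneg x) (hg_cont.intervalIntegrable _ _)
  -- (3) `∫_0^L g = L ∫_0^1 ψ`
  have h3 : ∫ x in (0 : ℝ)..L, g x = L * (4 / π - 8 / π ^ 2) := by
    simp only [hg]
    rw [intervalIntegral.integral_comp_div vkPsi hL0.ne', zero_div, div_self hL0.ne', integral_vkPsi,
      smul_eq_mul]
  -- (4) `∫_0^1 g ≤ 1`
  have h4 : ∫ x in (0 : ℝ)..1, g x ≤ 1 := by
    have h : (∫ x in (0 : ℝ)..1, g x) ≤ ∫ _ in (0 : ℝ)..1, (1 : ℝ) :=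
      intervalIntegral.integral_mono_on zero_le_one (hg_cont.intervalIntegrable _ _)
        intervalIntegrable_const fun x hx => hg_le_one x hx.1
    simpa using h
  -- (5) splitting at `1`
  have h5 : (∫ x in (0 : ℝ)..1, g x) + ∫ x in (1 : ℝ)..L, g x = ∫ x in (0 : ℝ)..L, g x :=
    intervalIntegral.integral_add_adjacent_intervals (hg_cont.intervalIntegrable _ _)
      (hg_cont.intervalIntegrable _ _)
  have hsum : vkDiagSum N = 2 * ∑ j ∈ Finset.Ico 1 (m + 1), g j := rfl
  rw [hsum]
  linarith



end Literature.RepresentationTheory.FiniteGroups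

end
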